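import Summits.HubbardSuperconductivity.HubbardSuperconductivity.Theorems.BalabanIRBirEveryGroundStateSourceShiftCore
import Literature.MathematicalPhysics.QuantumLattice.PairCorrelationsProofs
import Literature.MathematicalPhysics.QuantumLattice.SectorSpectrum
import Mathlib.Analysis.Normed.Module.FiniteDimension
import Mathlib.Topology.Instances.Matrix
import HarnessLib

/-!
# Crux `MesoscopicPairOrder` (stmt-HubbardSuperconductivity-7331), line `Sketch` (chord-floor half):
# finite-dimensional Danskin for sector energies (abstract part)

Support file for the crux (route `FunctionFieldCertificate`, pole-free half). The line's skeleton
(`Cruxes/MesoscopicPairOrder/Lines/Sketch.lean`) closes the crux from the stateless CHORD GAP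
`ε · m · R² · L² ≤ E_K(H_L + ε K_R) - E_K(H_L)` (`K_R` the box pair repulsion, `K = szSector N_L 0`,
`E_K = Matrix.minEnergyOn · K`) through the upper chord inequality. This file is the abstract linear
algebra behind the CONVERSE (used by `FunctionFieldCertificateMesoscopicPairOrderChord.lean` to show
that the load-bearing stub `stub_chordGap` is EQUIVALENT to the crux):

* `re_rayleigh_smul`, `re_star_dotProduct_smul_self`, `minEnergyOn_mul_re_le_re_rayleigh` —
  bookkeeping: Rayleigh quotients of `c • φ`, homogeneous variational principle on a sector;
* `mulVec_eq_smul_of_re_rayleigh_eq_minEnergyOn` — for a Hermitian `H` and an `H`-invariant subspace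
  `K`, a unit vector of `K` whose Rayleigh quotient equals the sector energy `E_K(H)` is an
  eigenvector (first variation of the nonnegative form `Re⟨φ, (H - E_K)φ⟩` on `K`);
* `isCompact_unit_inter_re_rayleigh_le` — the unit vectors of `K` with `Re⟨φ, Y φ⟩ ≤ b` form a
  compact set;
* `exists_chord_ge_of_forall_ground` — **Danskin's lower bound for the sector energy**: if every
  normalised sector ground state `ψ` of `H` has `κ₀ ≤ Re⟨ψ, Y ψ⟩` (ANY matrix `Y`), then for every
  `η > 0` some `ε > 0` has `ε (κ₀ - η) ≤ E_K(H + εY) - E_K(H)`. Proof without derivatives: the unit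
  vectors `φ ∈ K` with `Re⟨φ, Y φ⟩ ≤ κ₀ - η` form a compact set free of ground states, on which
  `Re⟨φ, H φ⟩ ≥ E_K(H) + d` for some `d > 0`; with `Re⟨φ, Y φ⟩ ≥ -Σ|Y_{st}|` a coupling
  `ε ≍ d` works for them, and any `ε` works for the others;
* `chord_ge_of_forall_penalisedGround` — the companion (robust) direction: a bound
  `c ≤ Re⟨φ, Y φ⟩` for the normalised sector ground states `φ` of the PENALISED `H + κY` gives
  `κ c ≤ E_K(H + κY) - E_K(H)` (lower chord inequality of the tree).

Together with the tree's upper chord inequality (`Theorems.chord_div_le_re_expect_of_eigen`) this is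
the finite-dimensional content of "the one-sided derivative `∂⁺_ε E_K(H + εY)|₀` is
`min {Re⟨ψ, Yψ⟩ : ψ a sector ground state}`" (degenerate Hellmann–Feynman / Danskin).
Sources: J. M. Danskin, *The Theory of Max-Min* (1967) Ch. I; R. B. Griffiths, J. Math. Phys. 5
(1964) 1215 §III; T. Kato, *Perturbation Theory for Linear Operators* (1966) II §6.1; H. Tasaki,
*Physics and Mathematics of Quantum Many-Body Systems* (2020) §2.1. Folklore; no definition is
introduced.
-/

noncomputable section

-- the summit namespace `Summit.HubbardSuperconductivity.HubbardSuperconductivity.…` repeats the problem name by design (D-0017)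
set_option linter.dupNamespace false

namespace Summit.HubbardSuperconductivity.HubbardSuperconductivity.Theorems.FunctionFieldCertificate

open Matrix Finset Filter
open Literature.Probability.LatticeModels Literature.MathematicalPhysics.QuantumLattice
open scoped ComplexOrder

/-! ### Abstract finite-dimensional part -/

section Abstract

variable {n : Type*} [Fintype n] [DecidableEq n]

omit [DecidableEq n] in
/-- Rayleigh quotients scale by `|c|²`: `⟨c φ, A (c φ)⟩ = (c̄ c) ⟨φ, A φ⟩`, in real parts. [folklore] -/
theorem re_rayleigh_smul (A : Matrix n n ℂ) (c : ℂ) (φ : n → ℂ) :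
    (star (c • φ) ⬝ᵥ A *ᵥ (c • φ)).re = ‖c‖ ^ 2 * (star φ ⬝ᵥ A *ᵥ φ).re := by
  rw [mulVec_smul, star_smul, smul_dotProduct, dotProduct_smul, smul_smul, Complex.star_def,
    Complex.conj_mul', smul_eq_mul, ← Complex.ofReal_pow, Complex.re_ofReal_mul]

omit [DecidableEq n] in
/-- `⟨c φ, c φ⟩ = |c|² ⟨φ, φ⟩`, in real parts. [folklore] -/
theorem re_star_dotProduct_smul_self (c : ℂ) (φ : n → ℂ) :
    (star (c • φ) ⬝ᵥ (c • φ)).re = ‖c‖ ^ 2 * (star φ ⬝ᵥ φ).re := by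
  rw [star_smul, smul_dotProduct, dotProduct_smul, smul_smul, Complex.star_def,
    Complex.conj_mul', smul_eq_mul, ← Complex.ofReal_pow, Complex.re_ofReal_mul]

omit [DecidableEq n] in
/-- **Homogeneous variational principle in a sector**: `E_K(A) · Re⟨φ, φ⟩ ≤ Re⟨φ, A φ⟩` for every
`φ ∈ K` (normalise `φ ≠ 0` and use `minEnergyOn_le_re_rayleigh`). Tasaki (2020) §2.1. [folklore] -/
theorem minEnergyOn_mul_re_le_re_rayleigh (A : Matrix n n ℂ) (K : Submodule ℂ (n → ℂ)) {φ : n → ℂ}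
    (hφ : φ ∈ K) : A.minEnergyOn K * (star φ ⬝ᵥ φ).re ≤ (star φ ⬝ᵥ A *ᵥ φ).re := by
  by_cases h0 : φ = 0
  · subst h0
    simp
  obtain ⟨c, hc0, hc1⟩ := exists_smul_unit h0
  have hle := minEnergyOn_le_re_rayleigh A K (K.smul_mem c hφ) hc1
  rw [re_rayleigh_smul] at hle
  have h1 : ‖c‖ ^ 2 * (star φ ⬝ᵥ φ).re = 1 := by
    rw [← re_star_dotProduct_smul_self, hc1, Complex.one_re]
  have hpos : 0 < ‖c‖ ^ 2 := by positivity
  have key : ‖c‖ ^ 2 * (A.minEnergyOn K * (star φ ⬝ᵥ φ).re) ≤ ‖c‖ ^ 2 * (star φ ⬝ᵥ A *ᵥ φ).re :=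
    calc ‖c‖ ^ 2 * (A.minEnergyOn K * (star φ ⬝ᵥ φ).re)
        = A.minEnergyOn K * (‖c‖ ^ 2 * (star φ ⬝ᵥ φ).re) := by ring
      _ = A.minEnergyOn K := by rw [h1, mul_one]
      _ ≤ ‖c‖ ^ 2 * (star φ ⬝ᵥ A *ᵥ φ).re := hle
  exact le_of_mul_le_mul_left key hpos

/-- **A Rayleigh minimiser on an invariant subspace is an eigenvector.** Let `H` be Hermitian and
`K` an `H`-invariant subspace. If the unit vector `ψ ∈ K` attains the sector energy,
`Re⟨ψ, H ψ⟩ = E_K(H)`, then `H ψ = E_K(H) ψ`. Proof: with `A = H - E_K(H)` and `w = A ψ ∈ K`, the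
form `Re⟨φ, A φ⟩` is nonnegative on `K` and vanishes at `ψ`, so its first variation along `w`
vanishes: `0 ≤ Re⟨ψ - t w, A (ψ - t w)⟩ = -2t ‖w‖² + t² Re⟨w, A w⟩` for all real `t`, forcing
`w = 0`. Tasaki (2020) §2.1; Kato (1966) I §6.10. [folklore] -/
theorem mulVec_eq_smul_of_re_rayleigh_eq_minEnergyOn {H : Matrix n n ℂ} (hH : H.IsHermitian)
    (K : Submodule ℂ (n → ℂ)) (hHK : ∀ v ∈ K, H *ᵥ v ∈ K) {ψ : n → ℂ} (hψK : ψ ∈ K)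
    (hψ : star ψ ⬝ᵥ ψ = 1) (hmin : (star ψ ⬝ᵥ H *ᵥ ψ).re = H.minEnergyOn K) :
    H *ᵥ ψ = ((H.minEnergyOn K : ℝ) : ℂ) • ψ := by
  set E : ℝ := H.minEnergyOn K with hE
  set A : Matrix n n ℂ := H - ((E : ℝ) : ℂ) • (1 : Matrix n n ℂ) with hA
  have hAH : A.IsHermitian := by
    unfold Matrix.IsHermitian
    rw [hA, conjTranspose_sub, conjTranspose_smul, conjTranspose_one, hH.eq, Complex.star_def,
      Complex.conj_ofReal]
  have hAv : ∀ v : n → ℂ, A *ᵥ v = H *ᵥ v - ((E : ℝ) : ℂ) • v := fun v => by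
    rw [hA, sub_mulVec, smul_mulVec, one_mulVec]
  -- the form of `A` is nonnegative on `K` and vanishes at `ψ`
  have hform : ∀ φ : n → ℂ, (star φ ⬝ᵥ A *ᵥ φ).re = (star φ ⬝ᵥ H *ᵥ φ).re - E * (star φ ⬝ᵥ φ).re :=
    fun φ => by
      rw [hAv, dotProduct_sub, dotProduct_smul, Complex.sub_re, smul_eq_mul, Complex.re_ofReal_mul]
  have hpos : ∀ φ ∈ K, 0 ≤ (star φ ⬝ᵥ A *ᵥ φ).re := fun φ hφ => by
    rw [hform]
    have := minEnergyOn_mul_re_le_re_rayleigh H K hφ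
    linarith
  have hzero : (star ψ ⬝ᵥ A *ᵥ ψ).re = 0 := by
    rw [hform, hmin, hψ, Complex.one_re, mul_one, sub_self]
  -- the variation along `w = A ψ ∈ K`
  have hwK : A *ᵥ ψ ∈ K := by
    rw [hAv]
    exact K.sub_mem (hHK ψ hψK) (K.smul_mem _ hψK)
  have hcross : star ψ ⬝ᵥ A *ᵥ (A *ᵥ ψ) = star (A *ᵥ ψ) ⬝ᵥ (A *ᵥ ψ) :=
    (star_mulVec_dotProduct_of_isHermitian hAH ψ (A *ᵥ ψ)).symm
  have hexp : ∀ t : ℝ, (star (ψ - (t : ℂ) • A *ᵥ ψ) ⬝ᵥ A *ᵥ (ψ - (t : ℂ) • A *ᵥ ψ)).re =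
      -(2 * t) * (star (A *ᵥ ψ) ⬝ᵥ (A *ᵥ ψ)).re +
        t ^ 2 * (star (A *ᵥ ψ) ⬝ᵥ A *ᵥ (A *ᵥ ψ)).re := by
    intro t
    have h1 : star (ψ - (t : ℂ) • A *ᵥ ψ) ⬝ᵥ A *ᵥ (ψ - (t : ℂ) • A *ᵥ ψ) =
        star ψ ⬝ᵥ A *ᵥ ψ - (t : ℂ) * (star ψ ⬝ᵥ A *ᵥ (A *ᵥ ψ)) -
          (t : ℂ) * (star (A *ᵥ ψ) ⬝ᵥ (A *ᵥ ψ)) +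
          (t : ℂ) * (t : ℂ) * (star (A *ᵥ ψ) ⬝ᵥ A *ᵥ (A *ᵥ ψ)) := by
      simp only [mulVec_sub, mulVec_smul, star_sub, star_smul, sub_dotProduct, dotProduct_sub,
        smul_dotProduct, dotProduct_smul, smul_eq_mul, Complex.star_def, Complex.conj_ofReal]
      ring
    rw [h1, hcross]
    simp only [Complex.sub_re, Complex.add_re, Complex.re_ofReal_mul, hzero]
    have h2 : ((t : ℂ) * (t : ℂ) * (star (A *ᵥ ψ) ⬝ᵥ A *ᵥ (A *ᵥ ψ))).re =
        t ^ 2 * (star (A *ᵥ ψ) ⬝ᵥ A *ᵥ (A *ᵥ ψ)).re := by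
      rw [← Complex.ofReal_mul, Complex.re_ofReal_mul, sq]
    rw [h2]
    ring
  have hineq : ∀ t : ℝ, 0 < t →
      2 * (star (A *ᵥ ψ) ⬝ᵥ (A *ᵥ ψ)).re ≤ t * (star (A *ᵥ ψ) ⬝ᵥ A *ᵥ (A *ᵥ ψ)).re := by
    intro t ht
    have h := hpos (ψ - (t : ℂ) • A *ᵥ ψ) (K.sub_mem hψK (K.smul_mem (t : ℂ) hwK))
    rw [hexp t] at h
    nlinarith
  -- hence `‖w‖² ≤ 0`
  have hnw : (star (A *ᵥ ψ) ⬝ᵥ (A *ᵥ ψ)).re ≤ 0 := by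
    by_contra hcon
    push Not at hcon
    set a := (star (A *ᵥ ψ) ⬝ᵥ (A *ᵥ ψ)).re
    set b := (star (A *ᵥ ψ) ⬝ᵥ A *ᵥ (A *ᵥ ψ)).re
    have ht : 0 < a / (|b| + 1) := by positivity
    have h := hineq _ ht
    have hb : a / (|b| + 1) * b ≤ a / (|b| + 1) * |b| :=
      mul_le_mul_of_nonneg_left (le_abs_self b) ht.le
    have hlt : a / (|b| + 1) * |b| < a := by
      rw [div_mul_eq_mul_div, div_lt_iff₀ (by positivity)]
      nlinarith [abs_nonneg b]
    linarith
  have hw0 : A *ᵥ ψ = 0 := by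
    have h2 : ‖(WithLp.toLp 2 (A *ᵥ ψ) : EuclideanSpace ℂ n)‖ ^ 2 = 0 :=
      le_antisymm ((norm_toLp_sq_eq_re (A *ᵥ ψ)).trans_le hnw) (sq_nonneg _)
    have h3 : (WithLp.toLp 2 (A *ᵥ ψ) : EuclideanSpace ℂ n) = 0 := by
      rwa [sq_eq_zero_iff, norm_eq_zero] at h2
    exact (WithLp.toLp_eq_zero 2).mp h3
  have := hAv ψ
  rw [hw0] at this
  exact (sub_eq_zero.mp this.symm)

omit [DecidableEq n] in
/-- The unit vectors of a subspace `K` on which `Re⟨φ, Y φ⟩ ≤ b` form a compact set (closed and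
bounded in the finite-dimensional space `n → ℂ`). [folklore] -/
theorem isCompact_unit_inter_re_rayleigh_le (Y : Matrix n n ℂ) (K : Submodule ℂ (n → ℂ)) (b : ℝ) :
    IsCompact {φ : n → ℂ | star φ ⬝ᵥ φ = 1 ∧ φ ∈ K ∧ (star φ ⬝ᵥ Y *ᵥ φ).re ≤ b} := by
  have hcontY : Continuous fun φ : n → ℂ => (star φ ⬝ᵥ Y *ᵥ φ).re :=
    Complex.continuous_re.comp
      (continuous_star.dotProduct (continuous_const.matrix_mulVec continuous_id))
  have hclosed : IsClosed {φ : n → ℂ | star φ ⬝ᵥ φ = 1 ∧ φ ∈ K ∧ (star φ ⬝ᵥ Y *ᵥ φ).re ≤ b} :=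
    (isClosed_eq (continuous_star.dotProduct continuous_id) continuous_const).inter
      ((Submodule.closed_of_finiteDimensional K).inter (isClosed_le hcontY continuous_const))
  have hbdd : Bornology.IsBounded
      {φ : n → ℂ | star φ ⬝ᵥ φ = 1 ∧ φ ∈ K ∧ (star φ ⬝ᵥ Y *ᵥ φ).re ≤ b} := by
    refine (Metric.isBounded_closedBall (x := (0 : n → ℂ)) (r := 1)).subset ?_
    rintro φ ⟨h1, -, -⟩
    rw [Metric.mem_closedBall, dist_zero_right]
    have hn2 : ‖(WithLp.toLp 2 φ : EuclideanSpace ℂ n)‖ = 1 := by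
      have h2 := norm_toLp_sq_eq_re φ
      rw [h1, Complex.one_re] at h2
      exact (pow_eq_one_iff_of_nonneg (norm_nonneg _) two_ne_zero).1 h2
    refine (pi_norm_le_iff_of_nonneg zero_le_one).2 fun s => ?_
    calc ‖φ s‖ = ‖(WithLp.toLp 2 φ : EuclideanSpace ℂ n) s‖ := rfl
      _ ≤ ‖(WithLp.toLp 2 φ : EuclideanSpace ℂ n)‖ := PiLp.norm_apply_le _ _
      _ = 1 := hn2
  exact Metric.isCompact_of_isClosed_isBounded hclosed hbdd

/-- **Danskin's lower bound for the sector energy** (degenerate first-order perturbation theory,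
lower half). Let `H` be Hermitian, `K` an `H`-invariant subspace containing a unit vector, `Y` ANY
matrix, and suppose every normalised sector ground state `ψ` of `H` (`ψ ∈ K`, `H ψ = E_K(H) ψ`) has
`κ₀ ≤ Re⟨ψ, Y ψ⟩`. Then for every `η > 0` there is `ε > 0` with
`ε (κ₀ - η) ≤ E_K(H + εY) - E_K(H)`. Proof: the unit vectors `φ ∈ K` with `Re⟨φ, Y φ⟩ ≤ κ₀ - η`
form a compact set (`isCompact_unit_inter_re_rayleigh_le`) containing no ground state, so — a
Rayleigh minimiser being a ground state (`mulVec_eq_smul_of_re_rayleigh_eq_minEnergyOn`) — the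
continuous `Re⟨φ, H φ⟩` exceeds `E_K(H)` by some `d > 0` on it; as `Re⟨φ, Y φ⟩ ≥ -Σ_{s,t}|Y_{st}|`
(`neg_sum_norm_le_re_rayleigh`), the coupling `ε = d/(Σ|Y_{st}| + |κ₀ - η| + 1)` gives
`Re⟨φ, (H + εY) φ⟩ ≥ E_K(H) + ε(κ₀ - η)` there, while the remaining unit vectors of `K` satisfy it for
every `ε > 0`. With the upper chord inequality (`Theorems.chord_div_le_re_expect_of_eigen`) this says
`∂⁺_ε E_K(H + εY)|₀ = min_{ground states} Re⟨ψ, Y ψ⟩`. Danskin (1967) Ch. I; Kato (1966) II §6.1;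
Griffiths, J. Math. Phys. 5 (1964) 1215 §III. [folklore] -/
theorem exists_chord_ge_of_forall_ground {H : Matrix n n ℂ} (hH : H.IsHermitian) (Y : Matrix n n ℂ)
    (K : Submodule ℂ (n → ℂ)) (hHK : ∀ v ∈ K, H *ᵥ v ∈ K) (hK : ∃ ψ ∈ K, star ψ ⬝ᵥ ψ = 1)
    {κ₀ η : ℝ} (hη : 0 < η)
    (hground : ∀ ψ ∈ K, star ψ ⬝ᵥ ψ = 1 → H *ᵥ ψ = ((H.minEnergyOn K : ℝ) : ℂ) • ψ →
      κ₀ ≤ (star ψ ⬝ᵥ Y *ᵥ ψ).re) :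
    ∃ ε : ℝ, 0 < ε ∧ ε * (κ₀ - η) ≤ (H + (ε : ℂ) • Y).minEnergyOn K - H.minEnergyOn K := by
  classical
  set E : ℝ := H.minEnergyOn K with hE
  set B : ℝ := ∑ s, ∑ t, ‖Y s t‖ with hB
  have hB0 : 0 ≤ B := Finset.sum_nonneg fun s _ => Finset.sum_nonneg fun t _ => norm_nonneg _
  set S : Set (n → ℂ) := {φ | star φ ⬝ᵥ φ = 1 ∧ φ ∈ K ∧ (star φ ⬝ᵥ Y *ᵥ φ).re ≤ κ₀ - η} with hS
  have hScpt : IsCompact S := isCompact_unit_inter_re_rayleigh_le Y K (κ₀ - η)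
  have hcontH : Continuous fun φ : n → ℂ => (star φ ⬝ᵥ H *ᵥ φ).re :=
    Complex.continuous_re.comp
      (continuous_star.dotProduct (continuous_const.matrix_mulVec continuous_id))
  -- pointwise form of the claim, for some coupling
  have key : ∃ ε : ℝ, 0 < ε ∧ ∀ φ ∈ K, star φ ⬝ᵥ φ = 1 →
      E + ε * (κ₀ - η) ≤ (star φ ⬝ᵥ H *ᵥ φ).re + ε * (star φ ⬝ᵥ Y *ᵥ φ).re := by
    by_cases hSne : S.Nonempty
    · obtain ⟨φ₀, hφ₀S, hmin⟩ := hScpt.exists_isMinOn hSne hcontH.continuousOn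
      obtain ⟨h01, h0K, h0Y⟩ := hφ₀S
      -- the minimum over the bad set lies strictly above the sector energy
      have hd : E < (star φ₀ ⬝ᵥ H *ᵥ φ₀).re := by
        rcases (minEnergyOn_le_re_rayleigh H K h0K h01).lt_or_eq with hlt | heq
        · exact hlt
        · exfalso
          have heig := mulVec_eq_smul_of_re_rayleigh_eq_minEnergyOn hH K hHK h0K h01 heq.symm
          have := hground φ₀ h0K h01 heig
          linarith
      set d : ℝ := (star φ₀ ⬝ᵥ H *ᵥ φ₀).re - E with hd'
      have hdpos : 0 < d := by rw [hd']; linarith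
      refine ⟨d / (B + |κ₀ - η| + 1), by positivity, fun φ hφK hφ => ?_⟩
      have hEφ := minEnergyOn_le_re_rayleigh H K hφK hφ
      by_cases hbad : (star φ ⬝ᵥ Y *ᵥ φ).re ≤ κ₀ - η
      · have h1 : (star φ₀ ⬝ᵥ H *ᵥ φ₀).re ≤ (star φ ⬝ᵥ H *ᵥ φ).re := hmin ⟨hφ, hφK, hbad⟩
        have h2 := neg_sum_norm_le_re_rayleigh Y hφ
        have h3 : d / (B + |κ₀ - η| + 1) * (B + |κ₀ - η| + 1) = d := by
          field_simp
        have h4 : κ₀ - η ≤ |κ₀ - η| := le_abs_self _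
        have hε0 : 0 ≤ d / (B + |κ₀ - η| + 1) := by positivity
        nlinarith [mul_le_mul_of_nonneg_left h2 hε0, mul_le_mul_of_nonneg_left h4 hε0]
      · push Not at hbad
        have hε0 : 0 ≤ d / (B + |κ₀ - η| + 1) := by positivity
        nlinarith [mul_le_mul_of_nonneg_left hbad.le hε0]
    · refine ⟨1, one_pos, fun φ hφK hφ => ?_⟩
      have hEφ := minEnergyOn_le_re_rayleigh H K hφK hφ
      have hgood : κ₀ - η < (star φ ⬝ᵥ Y *ᵥ φ).re := by
        by_contra hcon
        push Not at hcon
        exact hSne ⟨φ, hφ, hφK, hcon⟩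
      linarith
  -- pass to the infimum
  obtain ⟨ε, hε, hall⟩ := key
  refine ⟨ε, hε, ?_⟩
  obtain ⟨ψ₁, hψ₁K, hψ₁⟩ := hK
  rw [le_sub_iff_add_le']
  refine le_csInf ⟨_, ψ₁, hψ₁K, hψ₁, rfl⟩ ?_
  rintro e ⟨φ, hφK, hφ, rfl⟩
  rw [add_mulVec, dotProduct_add, Complex.add_re, smul_mulVec, dotProduct_smul, smul_eq_mul,
    Complex.re_ofReal_mul]
  exact hall φ hφK hφ

omit [DecidableEq n] in
/-- **The robust direction** (lower chord inequality, restated): if SOME normalised sector ground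
state `φ` of the penalised matrix `H + κY` exists and EVERY such `φ` has `c ≤ Re⟨φ, Y φ⟩`, then
`κ c ≤ E_K(H + κY) - E_K(H)` (`φ` is a trial state for `H`;
`Theorems.re_rayleigh_le_chord_div_of_penalisedGround_eigen`). So a margin that survives a small
REPULSION `κY` gives the chord gap with `κ` independent of anything else. Griffiths (1964) §III.
[folklore] -/
theorem chord_ge_of_forall_penalisedGround (H Y : Matrix n n ℂ) (K : Submodule ℂ (n → ℂ))
    {κ c : ℝ} (hκ : 0 < κ)
    (hex : ∃ φ ∈ K, star φ ⬝ᵥ φ = 1 ∧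
      (H + (κ : ℂ) • Y) *ᵥ φ = ((((H + (κ : ℂ) • Y).minEnergyOn K : ℝ)) : ℂ) • φ)
    (hall : ∀ φ ∈ K, star φ ⬝ᵥ φ = 1 →
      (H + (κ : ℂ) • Y) *ᵥ φ = ((((H + (κ : ℂ) • Y).minEnergyOn K : ℝ)) : ℂ) • φ →
        c ≤ (star φ ⬝ᵥ Y *ᵥ φ).re) :
    κ * c ≤ (H + (κ : ℂ) • Y).minEnergyOn K - H.minEnergyOn K := by
  obtain ⟨φ, hφK, hφ, heig⟩ := hex
  have h1 := re_rayleigh_le_chord_div_of_penalisedGround_eigen H Y K hκ hφK hφ heig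
  have h2 := hall φ hφK hφ heig
  rw [le_div_iff₀ hκ] at h1
  nlinarith

end Abstract

/-- **Registered form of Danskin's lower bound** (sub-goal `danskinSectorLowerBound` of crux
stmt-HubbardSuperconductivity-7331, line `Sketch`; verbatim `exists_chord_ge_of_forall_ground` with
all binders after the colon). [folklore] -/
theorem danskinSectorLowerBound : ∀ {n : Type} [Fintype n] [DecidableEq n] (H Y : Matrix n n ℂ) (K : Submodule ℂ (n → ℂ)) (κ₀ η : ℝ), H.IsHermitian → (∀ v ∈ K, H *ᵥ v ∈ K) → (∃ ψ ∈ K, star ψ ⬝ᵥ ψ = 1) → 0 < η → (∀ ψ ∈ K, star ψ ⬝ᵥ ψ = 1 → H *ᵥ ψ = ((H.minEnergyOn K : ℝ) : ℂ) • ψ → κ₀ ≤ (star ψ ⬝ᵥ Y *ᵥ ψ).re) → ∃ ε : ℝ, 0 < ε ∧ ε * (κ₀ - η) ≤ (H + (ε : ℂ) • Y).minEnergyOn K - H.minEnergyOn K :=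
  fun _ Y K _ _ hH hHK hK hη hground => exists_chord_ge_of_forall_ground hH Y K hHK hK hη hground

end Summit.HubbardSuperconductivity.HubbardSuperconductivity.Theorems.FunctionFieldCertificate
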